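import Literature.NumberTheory.LFunctions.LogIntegralBridgeProofs
import HarnessLib

/-!
# Discharge of `Literature.NumberTheory.LFunctions.isEquivalent_logIntegral_offsetLogIntegral`: `li ∼ Li` at `+∞`

D-0014 keeps `Literature/` sorry-free by stating cited results as named facts `def X : Prop`.
This sibling file of `Literature.NumberTheory.LFunctions.LogIntegral` proves the named fact
`Literature.NumberTheory.LFunctions.isEquivalent_logIntegral_offsetLogIntegral` — `logIntegral ~[atTop] offsetLogIntegral`, i.e.
`li x ∼ Li x` as `x → ∞` — as `theorem isEquivalent_logIntegral_offsetLogIntegral_holds`; users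
holding `(h : isEquivalent_logIntegral_offsetLogIntegral)` are fed
`isEquivalent_logIntegral_offsetLogIntegral_holds`.

Source and proof. Abramowitz–Stegun 5.1.3 (p. 228) defines `li x = ⨍₀ˣ dt/ln t = Ei (ln x)`
(`x > 1`); with `Li x = ∫₂ˣ dt/ln t` (`Literature.NumberTheory.LFunctions.offsetLogIntegral`) the two conventions differ by the
constant `li 2`: `li x − Li x = li 2` for `x > 1`. For the series definition of `Literature.NumberTheory.LFunctions.logIntegral`
(5.1.10 at `ln x`) this bridge is `Literature.NumberTheory.LFunctions.logIntegral_sub_offsetLogIntegral_eventuallyEq`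
(`LogIntegralBridgeProofs`, from `li' = 1/log`, `Literature.NumberTheory.LFunctions.hasDerivAt_logIntegral_holds`, and the
fundamental theorem of calculus). Since `Li x ≥ (x − 2)/log x → ∞`
(`Literature.tendsto_offsetLogIntegralPow_atTop 1` in `LogIntegralProofs`), the constant `li 2` is
`o(Li x)`, i.e. `li − Li = o(Li)`, which is `li ∼ Li` (`Asymptotics.IsEquivalent`). No new
definitions; Mathlib has no logarithmic integral (searched `logIntegral`, `LogIntegral`).

## References

* M. Abramowitz, I. A. Stegun (eds.), *Handbook of Mathematical Functions with Formulas, Graphs,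
  and Mathematical Tables*, National Bureau of Standards Applied Mathematics Series 55 (1964),
  ch. 5, §5.1, formula 5.1.3 (p. 228; `li x = Ei (ln x)`, `x > 1`) and 5.1.10
  (`Ei x = γ + ln x + ∑_{n ≥ 1} xⁿ/(n · n!)`, `x > 0`). [cite: AbramowitzStegun1964]
-/

noncomputable section

open Real Filter Asymptotics Set
open scoped Topology

namespace Literature.NumberTheory.LFunctions

section IsEquivalentLogIntegralOffsetLogIntegral

/-- `Li x → ∞` as `x → ∞` (the case `k = 1` of `tendsto_offsetLogIntegralPow_atTop`:
`Li x ≥ (x − 2)/log x`). [folklore] -/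
theorem tendsto_offsetLogIntegral_atTop : Tendsto offsetLogIntegral atTop atTop := by
  rw [← offsetLogIntegralPow_one]
  exact tendsto_offsetLogIntegralPow_atTop 1

/-- `li − Li = o(Li)` at `+∞`: the difference is eventually the constant `li 2`
(Abramowitz–Stegun 5.1.3; `logIntegral_sub_offsetLogIntegral_eventuallyEq`) while `Li x → ∞`.
[cite: AbramowitzStegun1964, 5.1.3] -/
theorem isLittleO_logIntegral_sub_offsetLogIntegral :
    (logIntegral - offsetLogIntegral) =o[atTop] offsetLogIntegral := by
  have hconst : (fun _ : ℝ => logIntegral 2) =o[atTop] offsetLogIntegral :=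
    Asymptotics.isLittleO_const_left.2
      (Or.inr (tendsto_norm_atTop_atTop.comp tendsto_offsetLogIntegral_atTop))
  refine hconst.congr' ?_ EventuallyEq.rfl
  filter_upwards [logIntegral_sub_offsetLogIntegral_eventuallyEq] with x hx
  simpa only [Pi.sub_apply] using hx.symm

/-- **Discharge of `isEquivalent_logIntegral_offsetLogIntegral`**: `li ∼ Li` at `+∞`, because
`li x − Li x = li 2` is constant for `x > 1` (Abramowitz–Stegun 5.1.3, `li x = ⨍₀ˣ dt/ln t`
versus `Li x = ∫₂ˣ dt/ln t`) while `Li x → ∞`, so `li − Li = o(Li)`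
(`isLittleO_logIntegral_sub_offsetLogIntegral`).
[cite: AbramowitzStegun1964, 5.1.3 (li − Li = li 2 constant)] -/
theorem isEquivalent_logIntegral_offsetLogIntegral_holds :
    isEquivalent_logIntegral_offsetLogIntegral :=
  (isLittleO_logIntegral_sub_offsetLogIntegral).isEquivalent

end IsEquivalentLogIntegralOffsetLogIntegral

end Literature.NumberTheory.LFunctions
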